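import Literature.NumberTheory.LFunctions.KMVCutoffWIncrementsAndSums
import Literature.NumberTheory.LFunctions.SiegelAbelSummation
import HarnessLib

/-!
# The diagonal of the mixed first moment: `Σ_n χ(n) W(n²/X)/n = L(1,χ) + O(D X^{−1/4})`
# for a non-principal character `χ` mod `D` (Abel summation against the Hölder-½ cutoff `W`)

Topic `Literature/NumberTheory/LFunctions` (namespace `Literature.NumberTheory.LFunctions.IwaniecSarnak`).
PROOFS ONLY — no definition, no named fact (D-0026). Cell `landau-siegel`, unit `littype-ls-input-ismix`
(I5, the mixed first moment (7.3)–(7.4) of [IwaniecSarnak2000] at prime level, weight 2): STEP 3.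

After the approximate functional equation (`IwaniecSarnakMixedCentralValueAFE.lean`) and the Petersson
formula, the diagonal `n₁ = n₂ = n` of the harmonic mixed moment `Σʰ L(½,f)L(½,f⊗χ)` is
`Σ_{n ≥ 1} χ(n) W(n²/X)/n` with `X = qD/4π²` and `W = KMV2000.cutoffW`. This file proves the
elementary estimate that turns it into the printed main term `L(1,χ)` of (7.4)
([IwaniecConversations2006, §7 (7.4)]: `Σ ω_f L(½,f)L(½,f_χ) ∼ N·L(1,χ)`):

* `norm_tsum_chi_cutoffW_sub_LFunction_one_le` — for `χ ≠ 1` mod `D` and `X ≥ 1`,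
  `‖Σ_{n ≥ 1} χ(n) W(n²/X)/n − L(1,χ)‖ ≤ 12 · D · X^{−1/4}` (and the series converges absolutely).

PROOF (Montgomery–Vaughan Thm. 4.8 style): Abel summation by the character partial sums
`S(N) = Σ_{n ≤ N} χ(n)`, `|S(N)| ≤ D` (tree `DirichletAbel.norm_partialSum_le`, MV (4.23)); with
`h(m) = W(m²/X)/m` and `h₀(m) = 1/m`, `Σ_{m ≤ N} χ(m)h(m) − Σ_{m ≤ N} χ(m)/m = S(N)g(N+1) +
Σ_{m ≤ N} S(m)(g(m) − g(m+1))`, `g = h − h₀ = (W(m²/X) − 1)/m`, and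
`|g(m) − g(m+1)| ≤ (W(m²/X) − W((m+1)²/X))/(m+1) + (1 − W(m²/X))/(m(m+1))`; the Hölder-½ bound
`W(u) − W(v) ≤ 2√(v−u)` (`KMV2000.cutoffW_sub_cutoffW_le`), monotonicity and `0 ≤ W ≤ 1` give
`Σ_m |g(m) − g(m+1)| ≤ 11 X^{−1/4}` uniformly; `Σ_{m ≤ N} χ(m)/m → L(1,χ)` is the tree's
`DirichletAbel.LFunction_eq_abelSum` (MV Thm. 4.8). Constants are crude and explicit.

WHAT THIS IS NOT: no claim about Landau–Siegel zeros; nothing here is specific to modular forms.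

## References

* [IwaniecConversations2006] H. Iwaniec, LNM 1891 (2006), §7 (7.3)–(7.4) p. 96 (held
  `book:friedlandernd-analytic-number-theory` p0096).
* [MontgomeryVaughan2007] H. L. Montgomery, R. C. Vaughan, *Multiplicative Number Theory I*, §4.3
  Thm. 4.8, (4.23) (Abel summation of `Σ χ(n) f(n)`).
* [KowalskiMichelVanderKam2000] §5 (22) p. 12 (the cutoff `W`).
-/

noncomputable section

open scoped Real Topology
open Complex Filter Finset
open Literature.NumberTheory.LFunctions.KMV2000
open Literature.NumberTheory.LFunctions.DirichletAbel

namespace Literature.NumberTheory.LFunctions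

namespace IwaniecSarnak

/-! ### Two telescoping sums -/

/-- `1/√x ≤ 2(√x − √(x−1))` for `x ≥ 1`. [folklore] -/
private theorem inv_sqrt_le_two_mul_sub {x : ℝ} (hx : 1 ≤ x) :
    (Real.sqrt x)⁻¹ ≤ 2 * (Real.sqrt x - Real.sqrt (x - 1)) := by
  set a := Real.sqrt x with ha
  set c := Real.sqrt (x - 1) with hc
  have ha0 : 0 < a := Real.sqrt_pos.mpr (by linarith)
  have hc0 : 0 ≤ c := Real.sqrt_nonneg _
  have hca : c ≤ a := Real.sqrt_le_sqrt (by linarith)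
  have hprod : (a - c) * (a + c) = 1 := by
    rw [mul_comm, ← sq_sub_sq, ha, hc, Real.sq_sqrt (by linarith), Real.sq_sqrt (by linarith)]
    ring
  rw [inv_le_iff_one_le_mul₀ ha0]
  nlinarith [sq_nonneg (a - c)]

/-- `1/(√x (x+1)) ≤ 2(1/√x − 1/√(x+1))` for `x ≥ 1`. [folklore] -/
private theorem inv_sqrt_mul_le_two_mul_sub {x : ℝ} (hx : 1 ≤ x) :
    (Real.sqrt x * (x + 1))⁻¹ ≤ 2 * ((Real.sqrt x)⁻¹ - (Real.sqrt (x + 1))⁻¹) := by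
  set a := Real.sqrt x with ha
  set b := Real.sqrt (x + 1) with hb
  have ha0 : 0 < a := Real.sqrt_pos.mpr (by linarith)
  have hb0 : 0 < b := Real.sqrt_pos.mpr (by linarith)
  have hab : a ≤ b := Real.sqrt_le_sqrt (by linarith)
  have hb2 : x + 1 = b ^ 2 := by rw [hb, Real.sq_sqrt (by linarith)]
  have hprod : (b - a) * (b + a) = 1 := by
    rw [mul_comm, ← sq_sub_sq, ha, hb, Real.sq_sqrt (by linarith), Real.sq_sqrt (by linarith)]
    ring
  rw [hb2, show (2 : ℝ) * (a⁻¹ - b⁻¹) = 2 * (b - a) / (a * b) by field_simp,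
    le_div_iff₀ (mul_pos ha0 hb0)]
  rw [show (a * b ^ 2)⁻¹ * (a * b) = b⁻¹ by field_simp, inv_le_iff_one_le_mul₀ hb0]
  nlinarith [sq_nonneg (b - a)]

/-- `Σ_{m=1}^{K} 1/√m ≤ 2√K` (`1/√m ≤ 2(√m − √(m−1))`, telescoping).
[cite: MontgomeryVaughan2007, §4.3 Thm. 4.8] -/
theorem sum_range_inv_sqrt_succ_le (K : ℕ) :
    ∑ n ∈ Finset.range K, (Real.sqrt ((n + 1 : ℕ) : ℝ))⁻¹ ≤ 2 * Real.sqrt K := by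
  have hterm : ∀ n : ℕ, (Real.sqrt ((n + 1 : ℕ) : ℝ))⁻¹ ≤
      2 * (Real.sqrt ((n + 1 : ℕ) : ℝ) - Real.sqrt (n : ℝ)) := by
    intro n
    have h := inv_sqrt_le_two_mul_sub (x := ((n + 1 : ℕ) : ℝ)) (by exact_mod_cast Nat.succ_pos n)
    have hn : ((n + 1 : ℕ) : ℝ) - 1 = (n : ℝ) := by push_cast; ring
    rwa [hn] at h
  calc ∑ n ∈ Finset.range K, (Real.sqrt ((n + 1 : ℕ) : ℝ))⁻¹
      ≤ ∑ n ∈ Finset.range K, 2 * (Real.sqrt ((n + 1 : ℕ) : ℝ) - Real.sqrt (n : ℝ)) :=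
        Finset.sum_le_sum fun n _ ↦ hterm n
    _ = 2 * Real.sqrt K := by
        rw [← Finset.mul_sum, Finset.sum_range_sub (fun n ↦ Real.sqrt (n : ℝ)) K]
        simp

/-- `Σ_{m=1}^{N} 1/(√m (m+1)) ≤ 2` (`1/(√m(m+1)) ≤ 2(1/√m − 1/√(m+1))`, telescoping).
[cite: MontgomeryVaughan2007, §4.3 Thm. 4.8] -/
theorem sum_range_inv_sqrt_mul_le_two (N : ℕ) :
    ∑ n ∈ Finset.range N, (Real.sqrt ((n + 1 : ℕ) : ℝ) * ((n + 2 : ℕ) : ℝ))⁻¹ ≤ 2 := by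
  set u : ℕ → ℝ := fun n ↦ (Real.sqrt ((n + 1 : ℕ) : ℝ))⁻¹ with hu
  have hterm : ∀ n : ℕ, (Real.sqrt ((n + 1 : ℕ) : ℝ) * ((n + 2 : ℕ) : ℝ))⁻¹ ≤
      2 * (u n - u (n + 1)) := by
    intro n
    have h := inv_sqrt_mul_le_two_mul_sub (x := ((n + 1 : ℕ) : ℝ))
      (by exact_mod_cast Nat.succ_pos n)
    have h1 : ((n + 1 : ℕ) : ℝ) + 1 = ((n + 2 : ℕ) : ℝ) := by push_cast; ring
    have h2 : ((n + 1 : ℕ) : ℝ) + 1 = ((n + 1 + 1 : ℕ) : ℝ) := by push_cast; ring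
    simp only [hu]
    rw [← h2]
    try rw [← h1]
    exact h
  calc ∑ n ∈ Finset.range N, (Real.sqrt ((n + 1 : ℕ) : ℝ) * ((n + 2 : ℕ) : ℝ))⁻¹
      ≤ ∑ n ∈ Finset.range N, 2 * (u n - u (n + 1)) := Finset.sum_le_sum fun n _ ↦ hterm n
    _ = 2 * (u 0 - u N) := by
        rw [← Finset.mul_sum]
        congr 1
        have h := Finset.sum_range_sub u N
        linarith [show ∑ n ∈ Finset.range N, (u n - u (n + 1)) =
          -∑ n ∈ Finset.range N, (u (n + 1) - u n) by
            rw [← Finset.sum_neg_distrib]; exact Finset.sum_congr rfl fun n _ ↦ by ring]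
    _ ≤ 2 := by
        have h0 : u 0 = 1 := by simp [hu]
        have hN : 0 ≤ u N := by simp only [hu]; positivity
        linarith

/-! ### The weight `w(m) = W(m²/X)`: increments and defect -/

section Weight

variable {X : ℝ}

/-- `min(1, x) ≤ √x` for `x ≥ 0`, in the form: `t ≤ 1`, `t ≤ x` ⇒ `t ≤ √x`. [folklore] -/
private theorem le_sqrt_of_le_one_of_le {t x : ℝ} (hx : 0 ≤ x) (h1 : t ≤ 1) (h2 : t ≤ x) :
    t ≤ Real.sqrt x := by
  rcases le_or_gt x 1 with hx1 | hx1
  · calc t ≤ x := h2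
      _ = Real.sqrt (x ^ 2) := (Real.sqrt_sq hx).symm
      _ ≤ Real.sqrt x := Real.sqrt_le_sqrt (by nlinarith)
  · exact h1.trans (Real.one_le_sqrt.mpr hx1.le)

/-- The defect of the weight: `0 ≤ 1 − W(m²/X) ≤ √(2m) · X^{−1/4}` for `X > 0`, `m ≥ 0`
(`1 − W(v) ≤ min(1, 2√v)` and `min(1,x) ≤ √x`). [cite: KowalskiMichelVanderKam2000, §5 (22) p. 12] -/
theorem one_sub_cutoffW_sq_div_le (hX : 0 < X) {m : ℝ} (hm : 0 ≤ m) :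
    1 - cutoffW (m ^ 2 / X) ≤ Real.sqrt (2 * m) * (Real.sqrt (Real.sqrt X))⁻¹ := by
  have hv : 0 ≤ m ^ 2 / X := by positivity
  have hs : 0 < Real.sqrt X := Real.sqrt_pos.mpr hX
  have h1 : 1 - cutoffW (m ^ 2 / X) ≤ 1 := by linarith [cutoffW_nonneg (m ^ 2 / X)]
  have h2 : 1 - cutoffW (m ^ 2 / X) ≤ 2 * m / Real.sqrt X := by
    calc 1 - cutoffW (m ^ 2 / X) ≤ 2 * Real.sqrt (m ^ 2 / X) := one_sub_cutoffW_le hv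
      _ = 2 * m / Real.sqrt X := by
          rw [Real.sqrt_div' _ hX.le, Real.sqrt_sq hm]; ring
  have h := le_sqrt_of_le_one_of_le (by positivity) h1 h2
  calc 1 - cutoffW (m ^ 2 / X) ≤ Real.sqrt (2 * m / Real.sqrt X) := h
    _ = Real.sqrt (2 * m) * (Real.sqrt (Real.sqrt X))⁻¹ := by
        rw [Real.sqrt_div' _ hs.le, div_eq_mul_inv]

/-- The increment of the weight: `0 ≤ W(m²/X) − W((m+1)²/X) ≤ 2√3 · √m / √X` for `X > 0`,
`m ≥ 1` (Hölder-½: `≤ 2√((2m+1)/X)`, and `2m + 1 ≤ 3m`). [cite: KowalskiMichelVanderKam2000, §5 (22) p. 12] -/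
theorem cutoffW_sq_div_sub_le (hX : 0 < X) {m : ℝ} (hm : 1 ≤ m) :
    cutoffW (m ^ 2 / X) - cutoffW ((m + 1) ^ 2 / X) ≤
      2 * Real.sqrt 3 * Real.sqrt m / Real.sqrt X := by
  have hu : 0 ≤ m ^ 2 / X := by positivity
  have huv : m ^ 2 / X ≤ (m + 1) ^ 2 / X := by gcongr; linarith
  calc cutoffW (m ^ 2 / X) - cutoffW ((m + 1) ^ 2 / X)
      ≤ 2 * Real.sqrt ((m + 1) ^ 2 / X - m ^ 2 / X) := cutoffW_sub_cutoffW_le hu huv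
    _ = 2 * (Real.sqrt (2 * m + 1) / Real.sqrt X) := by
        rw [← sub_div, Real.sqrt_div' _ hX.le]; ring_nf
    _ ≤ 2 * (Real.sqrt (3 * m) / Real.sqrt X) := by
        gcongr; linarith
    _ = 2 * Real.sqrt 3 * Real.sqrt m / Real.sqrt X := by
        rw [Real.sqrt_mul (by norm_num : (0:ℝ) ≤ 3)]; ring

/-- Monotonicity of the weight in `m`: `W((m+1)²/X) ≤ W(m²/X)` (`m ≥ 0`, `X > 0`).
[cite: KowalskiMichelVanderKam2000, §5 (22) p. 12] -/
theorem cutoffW_sq_div_antitone (hX : 0 < X) {m : ℝ} (hm : 0 ≤ m) :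
    cutoffW ((m + 1) ^ 2 / X) ≤ cutoffW (m ^ 2 / X) := by
  refine cutoffW_antitoneOn (show 0 ≤ m ^ 2 / X by positivity)
    (show 0 ≤ (m + 1) ^ 2 / X by positivity) ?_
  gcongr; linarith

end Weight

/-! ### The two sums of increments of `g(m) = (W(m²/X) − 1)/m` -/

section Increments

variable {X : ℝ}

/-- **First increment sum**: for `X ≥ 1` and all `N`,
`Σ_{m=1}^{N} (W(m²/X) − W((m+1)²/X))/(m+1) ≤ 8 · X^{−1/4}`: the terms `m ≤ √X` by the Hölder
increment `≤ 2√3 √m/√X` and `Σ_{m ≤ K} 1/√m ≤ 2√K`, the terms `m > √X` by telescoping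
(`≤ W(K+1…)/(K+1) ≤ 1/√X`). [cite: MontgomeryVaughan2007, §4.3 Thm. 4.8] -/
theorem sum_cutoffW_increment_div_le (hX : 1 ≤ X) (N : ℕ) :
    ∑ n ∈ Finset.range N,
        (cutoffW (((n + 1 : ℕ) : ℝ) ^ 2 / X) - cutoffW (((n + 2 : ℕ) : ℝ) ^ 2 / X)) /
          ((n + 2 : ℕ) : ℝ) ≤ 8 * (Real.sqrt (Real.sqrt X))⁻¹ := by
  have hX0 : 0 < X := by linarith
  set s : ℝ := Real.sqrt (Real.sqrt X) with hs_def
  have hsX : Real.sqrt X = s ^ 2 := by rw [hs_def, Real.sq_sqrt (Real.sqrt_nonneg X)]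
  have hs1 : 1 ≤ s := by
    rw [hs_def]; exact Real.one_le_sqrt.mpr (Real.one_le_sqrt.mpr hX)
  have hs0 : 0 < s := by linarith
  -- the weight and its increments
  set w : ℕ → ℝ := fun m ↦ cutoffW (((m : ℕ) : ℝ) ^ 2 / X) with hw_def
  have hw_nonneg : ∀ m, 0 ≤ w m := fun m ↦ cutoffW_nonneg _
  have hw_le_one : ∀ m, w m ≤ 1 := fun m ↦ cutoffW_le_one (by positivity)
  have hw_anti : ∀ m : ℕ, w (m + 1) ≤ w m := by
    intro m
    simp only [hw_def]
    push_cast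
    exact cutoffW_sq_div_antitone hX0 (Nat.cast_nonneg m)
  have hterm_eq : ∀ n : ℕ, (cutoffW (((n + 1 : ℕ) : ℝ) ^ 2 / X) -
      cutoffW (((n + 2 : ℕ) : ℝ) ^ 2 / X)) / ((n + 2 : ℕ) : ℝ) = (w (n + 1) - w (n + 2)) / ((n + 2 : ℕ) : ℝ) := by
    intro n; simp only [hw_def]
  simp_rw [hterm_eq]
  have hincr_nonneg : ∀ n : ℕ, 0 ≤ w (n + 1) - w (n + 2) := fun n ↦ sub_nonneg.mpr (hw_anti (n + 1))
  -- split at `K = ⌊√X⌋`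
  set K : ℕ := ⌊Real.sqrt X⌋₊ with hK
  have hKs : (K : ℝ) ≤ s ^ 2 := by rw [← hsX]; exact Nat.floor_le (Real.sqrt_nonneg X)
  have hsK : s ^ 2 < (K : ℝ) + 1 := by rw [← hsX]; exact Nat.lt_floor_add_one _
  rw [← Finset.sum_filter_add_sum_filter_not (Finset.range N) (fun n ↦ n < K)]
  -- part 1: `n < K`
  have hpart1 : ∑ n ∈ (Finset.range N).filter (fun n ↦ n < K),
      (w (n + 1) - w (n + 2)) / ((n + 2 : ℕ) : ℝ) ≤ 4 * Real.sqrt 3 * s⁻¹ := by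
    have hb : ∀ n : ℕ, (w (n + 1) - w (n + 2)) / ((n + 2 : ℕ) : ℝ) ≤
        (2 * Real.sqrt 3 / Real.sqrt X) * (Real.sqrt ((n + 1 : ℕ) : ℝ))⁻¹ := by
      intro n
      have hm : (1 : ℝ) ≤ ((n + 1 : ℕ) : ℝ) := by exact_mod_cast Nat.succ_pos n
      have hm0 : (0 : ℝ) < ((n + 1 : ℕ) : ℝ) := by positivity
      have hsq : 0 < Real.sqrt ((n + 1 : ℕ) : ℝ) := Real.sqrt_pos.mpr hm0
      have h := cutoffW_sq_div_sub_le hX0 hm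
      have h2 : (((n + 1 : ℕ) : ℝ) + 1) = ((n + 2 : ℕ) : ℝ) := by push_cast; ring
      rw [h2] at h
      have hn2 : (0 : ℝ) < ((n + 2 : ℕ) : ℝ) := by positivity
      have hwdiff : w (n + 1) - w (n + 2) ≤ 2 * Real.sqrt 3 * Real.sqrt ((n + 1 : ℕ) : ℝ) / Real.sqrt X := by
        simp only [hw_def]; exact h
      calc (w (n + 1) - w (n + 2)) / ((n + 2 : ℕ) : ℝ)
          ≤ (2 * Real.sqrt 3 * Real.sqrt ((n + 1 : ℕ) : ℝ) / Real.sqrt X) / ((n + 2 : ℕ) : ℝ) :=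
            div_le_div_of_nonneg_right hwdiff hn2.le
        _ ≤ (2 * Real.sqrt 3 * Real.sqrt ((n + 1 : ℕ) : ℝ) / Real.sqrt X) / ((n + 1 : ℕ) : ℝ) :=
            div_le_div_of_nonneg_left (by positivity) hm0 (by push_cast; linarith)
        _ = (2 * Real.sqrt 3 / Real.sqrt X) * (Real.sqrt ((n + 1 : ℕ) : ℝ) / ((n + 1 : ℕ) : ℝ)) := by
            ring
        _ = (2 * Real.sqrt 3 / Real.sqrt X) * (Real.sqrt ((n + 1 : ℕ) : ℝ))⁻¹ := by
            rw [Real.sqrt_div_self', one_div]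
    calc ∑ n ∈ (Finset.range N).filter (fun n ↦ n < K), (w (n + 1) - w (n + 2)) / ((n + 2 : ℕ) : ℝ)
        ≤ ∑ n ∈ (Finset.range N).filter (fun n ↦ n < K),
            (2 * Real.sqrt 3 / Real.sqrt X) * (Real.sqrt ((n + 1 : ℕ) : ℝ))⁻¹ :=
          Finset.sum_le_sum fun n _ ↦ hb n
      _ ≤ ∑ n ∈ Finset.range K, (2 * Real.sqrt 3 / Real.sqrt X) * (Real.sqrt ((n + 1 : ℕ) : ℝ))⁻¹ := by
          apply Finset.sum_le_sum_of_subset_of_nonneg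
          · intro n hn
            simp only [Finset.mem_filter, Finset.mem_range] at hn ⊢
            exact hn.2
          · intro n _ _; positivity
      _ ≤ (2 * Real.sqrt 3 / Real.sqrt X) * (2 * Real.sqrt K) := by
          rw [← Finset.mul_sum]
          exact mul_le_mul_of_nonneg_left (sum_range_inv_sqrt_succ_le K) (by positivity)
      _ ≤ (2 * Real.sqrt 3 / Real.sqrt X) * (2 * s) := by
          gcongr
          calc Real.sqrt K ≤ Real.sqrt (s ^ 2) := Real.sqrt_le_sqrt hKs
            _ = s := Real.sqrt_sq hs0.le
      _ = 4 * Real.sqrt 3 * s⁻¹ := by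
          rw [hsX]; field_simp; ring
  -- part 2: `n ≥ K`, telescoping
  have hpart2 : ∑ n ∈ (Finset.range N).filter (fun n ↦ ¬ n < K),
      (w (n + 1) - w (n + 2)) / ((n + 2 : ℕ) : ℝ) ≤ s⁻¹ := by
    have hset : (Finset.range N).filter (fun n ↦ ¬ n < K) = Finset.Ico K N := by
      ext n
      simp only [Finset.mem_filter, Finset.mem_range, Finset.mem_Ico, not_lt]
      tauto
    rw [hset]
    have hK1 : (0 : ℝ) < (K : ℝ) + 1 := by positivity
    calc ∑ n ∈ Finset.Ico K N, (w (n + 1) - w (n + 2)) / ((n + 2 : ℕ) : ℝ)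
        ≤ ∑ n ∈ Finset.Ico K N, (w (n + 1) - w (n + 2)) / ((K : ℝ) + 1) := by
          refine Finset.sum_le_sum fun n hn ↦ ?_
          simp only [Finset.mem_Ico] at hn
          apply div_le_div_of_nonneg_left (hincr_nonneg n) hK1
          push_cast
          have : (K : ℝ) ≤ n := by exact_mod_cast hn.1
          linarith
      _ = (∑ n ∈ Finset.Ico K N, (w (n + 1) - w (n + 2))) / ((K : ℝ) + 1) := by
          rw [Finset.sum_div]
      _ ≤ 1 / ((K : ℝ) + 1) := by
          gcongr
          -- telescoping: the sum is `w(K+1) − w(N+1) ≤ w(K+1) ≤ 1` (or empty)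
          rw [Finset.sum_Ico_eq_sum_range]
          have htel : ∀ L : ℕ, ∑ k ∈ Finset.range L, (w (K + k + 1) - w (K + k + 2)) =
              w (K + 1) - w (K + L + 1) := by
            intro L
            induction L with
            | zero => simp
            | succ L ih =>
                rw [Finset.sum_range_succ, ih]
                rw [show K + L + 2 = K + (L + 1) + 1 by ring]
                ring
          rw [htel]
          linarith [hw_le_one (K + 1), hw_nonneg (K + (N - K) + 1)]
      _ ≤ s⁻¹ := by
          rw [one_div]
          apply inv_anti₀ hs0
          nlinarith
  calc _ ≤ 4 * Real.sqrt 3 * s⁻¹ + s⁻¹ := add_le_add hpart1 hpart2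
    _ ≤ 8 * s⁻¹ := by
        have h3 : Real.sqrt 3 ≤ 7 / 4 := by
          rw [show (7 / 4 : ℝ) = Real.sqrt ((7 / 4) ^ 2) by rw [Real.sqrt_sq (by norm_num)]]
          exact Real.sqrt_le_sqrt (by norm_num)
        have hsi : 0 < s⁻¹ := inv_pos.mpr hs0
        nlinarith

/-- **Second increment sum**: for `X > 0` and all `N`,
`Σ_{m=1}^{N} (1 − W(m²/X))/(m(m+1)) ≤ 3 · X^{−1/4}` (defect `≤ √(2m) X^{−1/4}` and
`Σ 1/(√m(m+1)) ≤ 2`). [cite: MontgomeryVaughan2007, §4.3 Thm. 4.8] -/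
theorem sum_one_sub_cutoffW_div_le (hX : 0 < X) (N : ℕ) :
    ∑ n ∈ Finset.range N,
        (1 - cutoffW (((n + 1 : ℕ) : ℝ) ^ 2 / X)) / (((n + 1 : ℕ) : ℝ) * ((n + 2 : ℕ) : ℝ)) ≤
      3 * (Real.sqrt (Real.sqrt X))⁻¹ := by
  set s : ℝ := Real.sqrt (Real.sqrt X) with hs_def
  have hs0 : 0 < s := Real.sqrt_pos.mpr (Real.sqrt_pos.mpr hX)
  have hb : ∀ n : ℕ, (1 - cutoffW (((n + 1 : ℕ) : ℝ) ^ 2 / X)) / (((n + 1 : ℕ) : ℝ) * ((n + 2 : ℕ) : ℝ))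
      ≤ Real.sqrt 2 * s⁻¹ * (Real.sqrt ((n + 1 : ℕ) : ℝ) * ((n + 2 : ℕ) : ℝ))⁻¹ := by
    intro n
    have hm0 : (0 : ℝ) < ((n + 1 : ℕ) : ℝ) := by positivity
    have hn2 : (0 : ℝ) < ((n + 2 : ℕ) : ℝ) := by positivity
    have hsq : 0 < Real.sqrt ((n + 1 : ℕ) : ℝ) := Real.sqrt_pos.mpr hm0
    have h := one_sub_cutoffW_sq_div_le hX hm0.le
    rw [Real.sqrt_mul (by norm_num : (0:ℝ) ≤ 2)] at h
    calc (1 - cutoffW (((n + 1 : ℕ) : ℝ) ^ 2 / X)) / (((n + 1 : ℕ) : ℝ) * ((n + 2 : ℕ) : ℝ))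
        ≤ (Real.sqrt 2 * Real.sqrt ((n + 1 : ℕ) : ℝ) * s⁻¹) / (((n + 1 : ℕ) : ℝ) * ((n + 2 : ℕ) : ℝ)) :=
          div_le_div_of_nonneg_right h (by positivity)
      _ = Real.sqrt 2 * s⁻¹ *
            ((Real.sqrt ((n + 1 : ℕ) : ℝ) / ((n + 1 : ℕ) : ℝ)) * (((n + 2 : ℕ) : ℝ))⁻¹) := by
          rw [div_eq_mul_inv (Real.sqrt _)]
          field_simp
      _ = Real.sqrt 2 * s⁻¹ * (Real.sqrt ((n + 1 : ℕ) : ℝ) * ((n + 2 : ℕ) : ℝ))⁻¹ := by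
          rw [Real.sqrt_div_self', one_div, ← mul_inv]
  calc _ ≤ ∑ n ∈ Finset.range N,
        Real.sqrt 2 * s⁻¹ * (Real.sqrt ((n + 1 : ℕ) : ℝ) * ((n + 2 : ℕ) : ℝ))⁻¹ :=
        Finset.sum_le_sum fun n _ ↦ hb n
    _ ≤ Real.sqrt 2 * s⁻¹ * 2 := by
        rw [← Finset.mul_sum]
        exact mul_le_mul_of_nonneg_left (sum_range_inv_sqrt_mul_le_two N) (by positivity)
    _ ≤ 3 * s⁻¹ := by
        have h2 : Real.sqrt 2 ≤ 3 / 2 := by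
          rw [show (3 / 2 : ℝ) = Real.sqrt ((3 / 2) ^ 2) by rw [Real.sqrt_sq (by norm_num)]]
          exact Real.sqrt_le_sqrt (by norm_num)
        have hsi : 0 < s⁻¹ := inv_pos.mpr hs0
        nlinarith

end Increments

/-! ### Abel summation against the character and the comparison with `L(1,χ)` -/

section Abel

variable {D : ℕ} [NeZero D] (χ : DirichletCharacter ℂ D)

omit [NeZero D] in
/-- **Abel summation** (MV Thm. 1.3 / (4.23)): for any `h : ℕ → ℂ`,
`Σ_{m=1}^{N} χ(m) h(m) = S(N) h(N+1) + Σ_{m=1}^{N} S(m) (h(m) − h(m+1))`, `S(m) = Σ_{j ≤ m} χ(j)`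
(the tree's `DirichletAbel.partialSum`). [cite: MontgomeryVaughan2007, §1.3 Thm. 1.3] -/
theorem sum_chi_mul_eq_abel (h : ℕ → ℂ) (N : ℕ) :
    ∑ n ∈ Finset.range N, χ ((n + 1 : ℕ) : ZMod D) * h (n + 1) =
      partialSum χ N * h (N + 1) +
        ∑ n ∈ Finset.range N, partialSum χ (n + 1) * (h (n + 1) - h (n + 2)) := by
  induction N with
  | zero => simp
  | succ N ih =>
      rw [Finset.sum_range_succ, Finset.sum_range_succ, ih, partialSum_succ]
      ring

/-- The increments of `g(m) = (W(m²/X) − 1)/m`: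
`|g(m) − g(m+1)| ≤ (W(m²/X) − W((m+1)²/X))/(m+1) + (1 − W(m²/X))/(m(m+1))` for `m ≥ 1`, `X > 0`.
[cite: MontgomeryVaughan2007, §4.3 Thm. 4.8] -/
theorem abs_weightDefect_sub_le {X : ℝ} (hX : 0 < X) {m : ℝ} (hm : 1 ≤ m) :
    |(cutoffW (m ^ 2 / X) - 1) / m - (cutoffW ((m + 1) ^ 2 / X) - 1) / (m + 1)| ≤
      (cutoffW (m ^ 2 / X) - cutoffW ((m + 1) ^ 2 / X)) / (m + 1) +
        (1 - cutoffW (m ^ 2 / X)) / (m * (m + 1)) := by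
  have hm0 : 0 < m := by linarith
  have hm1 : 0 < m + 1 := by linarith
  set a := cutoffW (m ^ 2 / X) with ha
  set b := cutoffW ((m + 1) ^ 2 / X) with hb
  have hab : b ≤ a := cutoffW_sq_div_antitone hX hm0.le
  have ha1 : a ≤ 1 := cutoffW_le_one (by positivity)
  have hid : (a - 1) / m - (b - 1) / (m + 1) = (a - b) / (m + 1) - (1 - a) / (m * (m + 1)) := by
    field_simp
    ring
  rw [hid]
  have h1 : 0 ≤ (a - b) / (m + 1) := div_nonneg (sub_nonneg.mpr hab) hm1.le
  have h2 : 0 ≤ (1 - a) / (m * (m + 1)) := div_nonneg (sub_nonneg.mpr ha1) (by positivity)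
  calc |(a - b) / (m + 1) - (1 - a) / (m * (m + 1))|
      ≤ |(a - b) / (m + 1)| + |(1 - a) / (m * (m + 1))| := abs_sub _ _
    _ = (a - b) / (m + 1) + (1 - a) / (m * (m + 1)) := by rw [abs_of_nonneg h1, abs_of_nonneg h2]

/-- **The diagonal main term vs `L(1,χ)`**: for a non-principal character `χ` mod `D` and `X ≥ 1`,
the series `Σ_{n ≥ 1} χ(n) W(n²/X)/n` converges absolutely and
`‖Σ_{n ≥ 1} χ(n) W(n²/X)/n − L(1,χ)‖ ≤ 12 · D · X^{−1/4}` (`X^{−1/4} = 1/√(√X)`): Abel summation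
(`|S(N)| ≤ D`, MV (4.23)) against `g(m) = (W(m²/X) − 1)/m`, whose total variation is
`≤ 11 X^{−1/4}` (`sum_cutoffW_increment_div_le`, `sum_one_sub_cutoffW_div_le`), and
`Σ_{n ≤ N} χ(n)/n → L(1,χ)` (MV Thm. 4.8, tree `DirichletAbel.LFunction_eq_abelSum`). This is the
main term `L(1,χ)` of (7.4). [cite: IwaniecConversations2006, §7 (7.4) p. 96]
[cite: MontgomeryVaughan2007, §4.3 Thm. 4.8] -/
theorem norm_tsum_chi_cutoffW_sub_LFunction_one_le (hχ : χ ≠ 1) {X : ℝ} (hX : 1 ≤ X) :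
    Summable (fun n : ℕ ↦ χ ((n + 1 : ℕ) : ZMod D) *
        ((cutoffW (((n + 1 : ℕ) : ℝ) ^ 2 / X) / ((n + 1 : ℕ) : ℝ) : ℝ) : ℂ)) ∧
      ‖∑' n : ℕ, χ ((n + 1 : ℕ) : ZMod D) *
          ((cutoffW (((n + 1 : ℕ) : ℝ) ^ 2 / X) / ((n + 1 : ℕ) : ℝ) : ℝ) : ℂ) - χ.LFunction 1‖ ≤
        12 * D * (Real.sqrt (Real.sqrt X))⁻¹ := by
  have hX0 : 0 < X := by linarith
  set s : ℝ := Real.sqrt (Real.sqrt X) with hs_def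
  have hs0 : 0 < s := Real.sqrt_pos.mpr (Real.sqrt_pos.mpr hX0)
  have hD : (0 : ℝ) < D := by exact_mod_cast NeZero.pos D
  -- the weight and the two test functions
  set w : ℕ → ℝ := fun m ↦ cutoffW (((m : ℕ) : ℝ) ^ 2 / X) with hw_def
  have hw_nonneg : ∀ m, 0 ≤ w m := fun m ↦ cutoffW_nonneg _
  have hw_le_one : ∀ m, w m ≤ 1 := fun m ↦ cutoffW_le_one (by positivity)
  set h₁ : ℕ → ℂ := fun m ↦ ((w m / (m : ℝ) : ℝ) : ℂ) with hh₁
  set h₀ : ℕ → ℂ := fun m ↦ ((m : ℂ))⁻¹ with hh₀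
  set g : ℕ → ℂ := fun m ↦ h₁ m - h₀ m with hg
  have hg_eq : ∀ m : ℕ, g m = (((w m - 1) / (m : ℝ) : ℝ) : ℂ) := by
    intro m; simp only [hg, hh₁, hh₀]; push_cast; ring
  set F : ℕ → ℂ := fun n ↦ χ ((n + 1 : ℕ) : ZMod D) * h₁ (n + 1) with hF
  -- (1) absolute convergence: `‖F n‖ ≤ 48 X² / (n+1)²`
  have hF_norm : ∀ n : ℕ, ‖F n‖ ≤ 48 * X ^ 2 * (((n + 1 : ℕ) : ℝ) ^ 2)⁻¹ := by
    intro n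
    have hn : (1 : ℝ) ≤ ((n + 1 : ℕ) : ℝ) := by exact_mod_cast Nat.succ_pos n
    have hn0 : (0 : ℝ) < ((n + 1 : ℕ) : ℝ) := by positivity
    have hy : 0 < ((n + 1 : ℕ) : ℝ) ^ 2 / X := by positivity
    have hW := cutoffW_le_div_sq hy
    simp only [hF, hh₁, hw_def, norm_mul, Complex.norm_real, Real.norm_eq_abs]
    rw [abs_of_nonneg (div_nonneg (cutoffW_nonneg _) hn0.le)]
    have hm2 : (1 : ℝ) ≤ ((n + 1 : ℕ) : ℝ) ^ 2 := one_le_pow₀ hn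
    have hm2pos : (0 : ℝ) < ((n + 1 : ℕ) : ℝ) ^ 2 := by positivity
    have h48 : 48 / (((n + 1 : ℕ) : ℝ) ^ 2 / X) ^ 2 ≤ 48 * X ^ 2 * (((n + 1 : ℕ) : ℝ) ^ 2)⁻¹ := by
      rw [show 48 / (((n + 1 : ℕ) : ℝ) ^ 2 / X) ^ 2 =
          48 * X ^ 2 * ((((n + 1 : ℕ) : ℝ) ^ 2) * ((n + 1 : ℕ) : ℝ) ^ 2)⁻¹ by
        field_simp]
      gcongr 48 * X ^ 2 * ?_
      exact inv_anti₀ hm2pos (le_mul_of_one_le_right hm2pos.le hm2)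
    calc ‖χ ((n + 1 : ℕ) : ZMod D)‖ * (cutoffW (((n + 1 : ℕ) : ℝ) ^ 2 / X) / ((n + 1 : ℕ) : ℝ))
        ≤ 1 * (cutoffW (((n + 1 : ℕ) : ℝ) ^ 2 / X) / ((n + 1 : ℕ) : ℝ)) :=
          mul_le_mul_of_nonneg_right (χ.norm_le_one _) (div_nonneg (cutoffW_nonneg _) hn0.le)
      _ ≤ cutoffW (((n + 1 : ℕ) : ℝ) ^ 2 / X) := by
          rw [one_mul]; exact div_le_self (cutoffW_nonneg _) hn
      _ ≤ 48 / (((n + 1 : ℕ) : ℝ) ^ 2 / X) ^ 2 := hW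
      _ ≤ 48 * X ^ 2 * (((n + 1 : ℕ) : ℝ) ^ 2)⁻¹ := h48
  have hsum2 : Summable fun n : ℕ ↦ 48 * X ^ 2 * (((n + 1 : ℕ) : ℝ) ^ 2)⁻¹ := by
    have h := (summable_nat_add_iff 1).mpr (Real.summable_nat_pow_inv.mpr one_lt_two)
    exact (h.congr fun n ↦ by push_cast; rfl).mul_left _
  have hFs : Summable F := Summable.of_norm_bounded hsum2 hF_norm
  refine ⟨hFs, ?_⟩
  -- (2) partial sums
  have hM : Tendsto (fun N ↦ ∑ n ∈ Finset.range N, F n) atTop (𝓝 (∑' n, F n)) :=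
    hFs.hasSum.tendsto_sum_nat
  -- (3) `A_N = Σ_{m ≤ N} χ(m)/m → L(1,χ)`
  have hterm : ∀ n : ℕ, term χ n 1 = partialSum χ (n + 1) * (h₀ (n + 1) - h₀ (n + 2)) := by
    intro n
    simp only [term, hh₀, Complex.cpow_neg_one]
  have hA : Tendsto (fun N ↦ ∑ n ∈ Finset.range N, χ ((n + 1 : ℕ) : ZMod D) * h₀ (n + 1)) atTop
      (𝓝 (χ.LFunction 1)) := by
    have hL : χ.LFunction 1 = abelSum χ 1 := LFunction_eq_abelSum χ hχ (by simp)
    have hT : Tendsto (fun N ↦ ∑ n ∈ Finset.range N, term χ n 1) atTop (𝓝 (abelSum χ 1)) :=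
      (summable_term χ hχ (by simp : (0 : ℝ) < (1 : ℂ).re)).hasSum.tendsto_sum_nat
    have hS0 : Tendsto (fun N : ℕ ↦ partialSum χ N * h₀ (N + 1)) atTop (𝓝 0) := by
      rw [tendsto_zero_iff_norm_tendsto_zero]
      have hbd : ∀ N : ℕ, ‖partialSum χ N * h₀ (N + 1)‖ ≤ D * (1 / ((N : ℝ) + 1)) := by
        intro N
        rw [norm_mul]
        refine mul_le_mul (norm_partialSum_le χ hχ N) ?_ (norm_nonneg _) hD.le
        simp only [hh₀, norm_inv]
        rw [show ((N + 1 : ℕ) : ℂ) = (((N : ℝ) + 1 : ℝ) : ℂ) by push_cast; ring, Complex.norm_real,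
          Real.norm_of_nonneg (by positivity), one_div]
      have hlim : Tendsto (fun N : ℕ ↦ (D : ℝ) * (1 / ((N : ℝ) + 1))) atTop (𝓝 0) := by
        simpa using tendsto_one_div_add_atTop_nhds_zero_nat.const_mul (D : ℝ)
      exact squeeze_zero (fun N ↦ norm_nonneg _) hbd hlim
    have heq : (fun N ↦ ∑ n ∈ Finset.range N, χ ((n + 1 : ℕ) : ZMod D) * h₀ (n + 1)) =
        fun N ↦ partialSum χ N * h₀ (N + 1) + ∑ n ∈ Finset.range N, term χ n 1 := by
      funext N
      rw [sum_chi_mul_eq_abel χ h₀ N]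
      simp only [hterm]
    rw [heq, hL, ← zero_add (abelSum χ 1)]
    exact hS0.add hT
  -- (4) the difference via Abel summation of `g`
  have hdiff : ∀ N : ℕ, (∑ n ∈ Finset.range N, F n) -
      ∑ n ∈ Finset.range N, χ ((n + 1 : ℕ) : ZMod D) * h₀ (n + 1) =
        partialSum χ N * g (N + 1) +
          ∑ n ∈ Finset.range N, partialSum χ (n + 1) * (g (n + 1) - g (n + 2)) := by
    intro N
    rw [← sum_chi_mul_eq_abel χ g N, ← Finset.sum_sub_distrib]
    refine Finset.sum_congr rfl fun n _ ↦ ?_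
    simp only [hF, hg]
    ring
  -- (5) the uniform bound
  have hB : ∀ N : ℕ, ∑ n ∈ Finset.range N, ‖g (n + 1) - g (n + 2)‖ ≤ 11 * s⁻¹ := by
    intro N
    have hle : ∀ n : ℕ, ‖g (n + 1) - g (n + 2)‖ ≤
        (cutoffW (((n + 1 : ℕ) : ℝ) ^ 2 / X) - cutoffW (((n + 2 : ℕ) : ℝ) ^ 2 / X)) /
            ((n + 2 : ℕ) : ℝ) +
          (1 - cutoffW (((n + 1 : ℕ) : ℝ) ^ 2 / X)) / (((n + 1 : ℕ) : ℝ) * ((n + 2 : ℕ) : ℝ)) := by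
      intro n
      have hm : (1 : ℝ) ≤ ((n + 1 : ℕ) : ℝ) := by exact_mod_cast Nat.succ_pos n
      have h := abs_weightDefect_sub_le hX0 hm
      have h2 : ((n + 1 : ℕ) : ℝ) + 1 = ((n + 2 : ℕ) : ℝ) := by push_cast; ring
      rw [h2] at h
      rw [hg_eq, hg_eq, ← Complex.ofReal_sub, Complex.norm_real, Real.norm_eq_abs]
      simp only [hw_def]
      exact h
    calc ∑ n ∈ Finset.range N, ‖g (n + 1) - g (n + 2)‖
        ≤ ∑ n ∈ Finset.range N,
            ((cutoffW (((n + 1 : ℕ) : ℝ) ^ 2 / X) - cutoffW (((n + 2 : ℕ) : ℝ) ^ 2 / X)) /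
              ((n + 2 : ℕ) : ℝ) +
            (1 - cutoffW (((n + 1 : ℕ) : ℝ) ^ 2 / X)) / (((n + 1 : ℕ) : ℝ) * ((n + 2 : ℕ) : ℝ))) :=
          Finset.sum_le_sum fun n _ ↦ hle n
      _ ≤ 8 * s⁻¹ + 3 * s⁻¹ := by
          rw [Finset.sum_add_distrib]
          exact add_le_add (sum_cutoffW_increment_div_le hX N) (sum_one_sub_cutoffW_div_le hX0 N)
      _ = 11 * s⁻¹ := by ring
  have hbound : ∀ N : ℕ, ‖(∑ n ∈ Finset.range N, F n) -
      ∑ n ∈ Finset.range N, χ ((n + 1 : ℕ) : ZMod D) * h₀ (n + 1)‖ ≤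
        D * (1 / ((N : ℝ) + 1)) + 11 * D * s⁻¹ := by
    intro N
    rw [hdiff N]
    have hgN : ‖g (N + 1)‖ ≤ 1 / ((N : ℝ) + 1) := by
      rw [hg_eq, Complex.norm_real, Real.norm_eq_abs]
      have hN1 : (0 : ℝ) < ((N + 1 : ℕ) : ℝ) := by positivity
      rw [abs_div, abs_of_pos hN1, show ((N + 1 : ℕ) : ℝ) = (N : ℝ) + 1 by push_cast; ring]
      gcongr
      rw [abs_sub_comm, abs_of_nonneg (sub_nonneg.mpr (hw_le_one _))]
      linarith [hw_nonneg (N + 1)]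
    calc ‖partialSum χ N * g (N + 1) +
          ∑ n ∈ Finset.range N, partialSum χ (n + 1) * (g (n + 1) - g (n + 2))‖
        ≤ ‖partialSum χ N * g (N + 1)‖ +
            ‖∑ n ∈ Finset.range N, partialSum χ (n + 1) * (g (n + 1) - g (n + 2))‖ :=
          norm_add_le _ _
      _ ≤ ‖partialSum χ N‖ * ‖g (N + 1)‖ +
            ∑ n ∈ Finset.range N, ‖partialSum χ (n + 1)‖ * ‖g (n + 1) - g (n + 2)‖ := by
          gcongr
          · exact (norm_mul _ _).le
          · exact (norm_sum_le _ _).trans (Finset.sum_le_sum fun n _ ↦ (norm_mul _ _).le)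
      _ ≤ D * (1 / ((N : ℝ) + 1)) + ∑ n ∈ Finset.range N, D * ‖g (n + 1) - g (n + 2)‖ := by
          gcongr with n _
          · exact norm_partialSum_le χ hχ N
          · exact norm_partialSum_le χ hχ (n + 1)
      _ ≤ D * (1 / ((N : ℝ) + 1)) + D * (11 * s⁻¹) := by
          rw [← Finset.mul_sum]
          gcongr
          exact hB N
      _ = D * (1 / ((N : ℝ) + 1)) + 11 * D * s⁻¹ := by ring
  -- (6) pass to the limit
  have hlim1 : Tendsto (fun N ↦ ‖(∑ n ∈ Finset.range N, F n) -
      ∑ n ∈ Finset.range N, χ ((n + 1 : ℕ) : ZMod D) * h₀ (n + 1)‖) atTop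
      (𝓝 ‖(∑' n, F n) - χ.LFunction 1‖) := (hM.sub hA).norm
  have hlim2 : Tendsto (fun N : ℕ ↦ (D : ℝ) * (1 / ((N : ℝ) + 1)) + 11 * D * s⁻¹) atTop
      (𝓝 (0 + 11 * D * s⁻¹)) := by
    refine Tendsto.add ?_ tendsto_const_nhds
    simpa using tendsto_one_div_add_atTop_nhds_zero_nat.const_mul (D : ℝ)
  have hle := le_of_tendsto_of_tendsto' hlim1 hlim2 hbound
  rw [zero_add] at hle
  calc ‖(∑' n, F n) - χ.LFunction 1‖ ≤ 11 * D * s⁻¹ := hle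
    _ ≤ 12 * D * s⁻¹ := by
        have : 0 < (D : ℝ) * s⁻¹ := mul_pos hD (inv_pos.mpr hs0)
        nlinarith

end Abel

end IwaniecSarnak

end Literature.NumberTheory.LFunctions

end
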